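import Mathlib.GroupTheory.Complement
import Summits.MatrixMultiplication.OmegaCensus.BoxNotUsefulLift

/-!
# ω-census, family (b3): conjecture C9 (b) — two commuting pairs with a common central involution commutator give box ratio `≥ 2`

HONEST FRAMING (pub-omega census; verbatim): lottery ticket; floor = certified bounds/negative ranges.
Census BOOKKEEPING (conjecture C9 of the cell, STRUCTURE.md §2; pub-omega kernel-l4 gen 15, task K-4 = the `p = 2` side of
`BoxBadOddPGroups`).  TYPE I of the minimal bad `2`-groups (`|G′| = 2`: `2^{1+4}_±`, `D₈ ∘ M_{2^n}`, …) is settled for ALL groups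
at once by a UNIFORM box, the two-pair analogue of stpp-1's `CentreIndexFourLower` (one pair, ratio `3/2`):

**Theorem (`exists_indep_two`).** Let `x₁, y₁, x₂, y₂ ∈ G` with `x₁y₁x₁⁻¹y₁⁻¹ = x₂y₂x₂⁻¹y₂⁻¹ = c`, `c ≠ 1` central with `c² = 1`,
and `x₁, y₁` commuting with `x₂, y₂`.  With `K` a transversal of `⟨c⟩` (`K ∩ cK = ∅`, `2|K| = |G|`) the `4|K| = 2|G|` cells
`(k, 1, 1)`, `(x₂⁻¹ c k, 1, x₂)`, `(y₂⁻¹ x₁⁻¹ c k, x₁, y₂)`, `(y₂⁻¹ y₁⁻¹ c k, y₁, y₂)` (`k ∈ K`) of the box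
`G × {1, x₁, y₁} × {1, x₂, y₂}` are independent: each of the sixteen word equations reduces, by the four commutations and the two
commutator relations, to `k = k'` in the same part or to `k = c k'` across parts.  (Why `2`: cells interact only inside a
`⟨c⟩`-coset "key" `y w g ⟨c⟩`, and on the `18` cells of a key the conflict graph is one fixed graph of independence number `4`;
for `2^{1+4}_+` this box attains the census value `α = 64 = 2·32` exactly.)
**Corollary (`not_boxUseful_of_two_pairs`).** Such a finite group is NOT box-useful (`5·2|G| ≥ 9|G|`).  The sequel
`BoxBadDerivedTwo` derives C9 (b) for every finite group all of whose commutators lie in `{1, c}` (`|G′| ≤ 2`).  This covers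
infinitely many minimal bad `2`-groups (every `D₈ ∘ M_{2^n}`, both `2^{1+4}_±`, every `2^{1+2k}_±`, `k ≥ 2`, and their central
products with abelian groups) without tables or `decide`.  Nothing here is progress on `ω`.
-/

namespace Summit.MatrixMultiplication.OmegaCensus

open Finset ProductBoxBound

namespace CommPairs

variable {G : Type*} [Group G]

/-- Membership in a part: `P = (u k, y, w)` for some `k ∈ K`. [folklore] -/
theorem mem_part [DecidableEq G] {K : Finset G} {u y w : G} {P : G × G × G}
    (h : P ∈ K.image (fun k => (u * k, y, w))) : ∃ k ∈ K, P = (u * k, y, w) := by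
  obtain ⟨k, hk, e⟩ := Finset.mem_image.1 h
  exact ⟨k, hk, e.symm⟩

/-- Solving the word equation `u k (u' k')⁻¹ a b = 1` for `k`. [folklore] -/
theorem solve_left {u k u' k' a b : G} (h : u * k * (u' * k')⁻¹ * a * b = 1) : k = u⁻¹ * b⁻¹ * a⁻¹ * u' * k' := by
  calc k = u⁻¹ * (u * k * (u' * k')⁻¹ * a * b) * b⁻¹ * a⁻¹ * u' * k' := by group
    _ = u⁻¹ * b⁻¹ * a⁻¹ * u' * k' := by rw [h]; group

/-- Right-associated conjugation rule `x (y (x⁻¹ t)) = c (y t)` from `x y x⁻¹ y⁻¹ = c`. [folklore] -/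
theorem conj_rule {x y c : G} (h : x * y * x⁻¹ * y⁻¹ = c) (t : G) : x * (y * (x⁻¹ * t)) = c * (y * t) := by
  rw [← h]; group

/-- Right-associated conjugation rule `y (x (y⁻¹ t)) = c⁻¹ (x t)` from `x y x⁻¹ y⁻¹ = c`. [folklore] -/
theorem conj_rule' {x y c : G} (h : x * y * x⁻¹ * y⁻¹ = c) (t : G) : y * (x * (y⁻¹ * t)) = c⁻¹ * (x * t) := by
  rw [← h]; group

/-- **The uniform ratio-`2` witness for two commuting pairs with a common central involution commutator.** [folklore] -/
theorem exists_indep_two [Fintype G] [DecidableEq G] {x₁ y₁ x₂ y₂ c : G}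
    (h1 : x₁ * y₁ * x₁⁻¹ * y₁⁻¹ = c) (h2 : x₂ * y₂ * x₂⁻¹ * y₂⁻¹ = c)
    (hxx : x₁ * x₂ = x₂ * x₁) (hxy : x₁ * y₂ = y₂ * x₁) (hyx : y₁ * x₂ = x₂ * y₁) (hyy : y₁ * y₂ = y₂ * y₁)
    (hc : c ∈ Subgroup.center G) (hc1 : c ≠ 1) (hcc : c * c = 1) :
    ∃ (Y W : Finset G) (J : Finset (G × G × G)), #Y = 3 ∧ #W = 3 ∧ J ⊆ univ ×ˢ (Y ×ˢ W) ∧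
      (∀ P ∈ J, ∀ P' ∈ J, P ≠ P' → cellWord P P' ≠ 1) ∧ #J = 2 * Fintype.card G := by
  classical
  -- normalisation rules
  have cxx : Commute x₂ x₁ := hxx.symm
  have cxy : Commute y₂ x₁ := hxy.symm
  have cyx : Commute x₂ y₁ := hyx.symm
  have cyy : Commute y₂ y₁ := hyy.symm
  have ccl : ∀ g t : G, g * (c * t) = c * (g * t) := fun g t => by
    rw [← mul_assoc, (Subgroup.mem_center_iff.mp hc g), mul_assoc]
  have cce : ∀ g : G, g * c = c * g := fun g => Subgroup.mem_center_iff.mp hc g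
  have hcinv : c⁻¹ = c := by rw [inv_eq_iff_mul_eq_one, hcc]
  have hcc2 : ∀ t : G, c * (c * t) = t := fun t => by rw [← mul_assoc, hcc, one_mul]
  have R1 := conj_rule h1
  have R1' : ∀ t : G, y₁ * (x₁ * (y₁⁻¹ * t)) = c * (x₁ * t) := fun t => by rw [conj_rule' h1, hcinv]
  have R2 := conj_rule h2
  have R2' : ∀ t : G, y₂ * (x₂ * (y₂⁻¹ * t)) = c * (x₂ * t) := fun t => by rw [conj_rule' h2, hcinv]
  -- distinctness inside `Y` and `W`
  have hx1 : x₁ ≠ 1 := by rintro rfl; apply hc1; rw [← h1]; group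
  have hy1 : y₁ ≠ 1 := by rintro rfl; apply hc1; rw [← h1]; group
  have hx1y1 : x₁ ≠ y₁ := by rintro rfl; apply hc1; rw [← h1]; group
  have hx2 : x₂ ≠ 1 := by rintro rfl; apply hc1; rw [← h2]; group
  have hy2 : y₂ ≠ 1 := by rintro rfl; apply hc1; rw [← h2]; group
  have hx2y2 : x₂ ≠ y₂ := by rintro rfl; apply hc1; rw [← h2]; group
  -- a transversal `K` of `⟨c⟩`
  set H : Subgroup G := Subgroup.zpowers c with hH
  have hcH : c ∈ H := Subgroup.mem_zpowers c
  have hcardH : Nat.card H = 2 := by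
    rw [hH, Nat.card_zpowers]; exact orderOf_eq_prime (by rw [pow_two]; exact hcc) hc1
  obtain ⟨R, hR, -⟩ := H.exists_isComplement_right 1
  have hRfin : R.Finite := Set.toFinite R
  set K : Finset G := hRfin.toFinset with hKdef
  have memK : ∀ r, r ∈ K ↔ r ∈ R := fun r => Set.Finite.mem_toFinset hRfin
  have cardK : 2 * #K = Fintype.card G := by
    have e1 : #K = H.index := by rw [hKdef, ← hR.ncard_right, Set.ncard_eq_toFinset_card R hRfin]
    rw [e1, ← hcardH, ← Nat.card_eq_fintype_card]; exact H.card_mul_index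
  have noC : ∀ b ∈ K, ∀ b' ∈ K, c * b ≠ b' := by
    intro b hb b' hb' e
    have := @hR.1 (⟨c, hcH⟩, ⟨b, (memK b).1 hb⟩) (⟨1, H.one_mem⟩, ⟨b', (memK b').1 hb'⟩) (by simpa using e)
    simp only [Prod.mk.injEq, Subtype.mk.injEq] at this
    exact hc1 this.1
  -- the four parts
  set A : Finset (G × G × G) := K.image (fun k => ((1 : G) * k, (1 : G), (1 : G))) with hA
  set B : Finset (G × G × G) := K.image (fun k => (x₂⁻¹ * c * k, (1 : G), x₂)) with hB
  set C : Finset (G × G × G) := K.image (fun k => (y₂⁻¹ * x₁⁻¹ * c * k, x₁, y₂)) with hC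
  set D : Finset (G × G × G) := K.image (fun k => (y₂⁻¹ * y₁⁻¹ * c * k, y₁, y₂)) with hD
  have card_part : ∀ (u y w : G), #(K.image (fun k => (u * k, y, w))) = #K := fun u y w =>
    card_image_of_injective _ (fun a b e => mul_left_cancel (congrArg Prod.fst e :))
  have tag2 : ∀ {u y w : G} {P : G × G × G}, P ∈ K.image (fun k => (u * k, y, w)) → P.2 = (y, w) := by
    intro u y w P h
    obtain ⟨k, -, rfl⟩ := mem_part h
    rfl
  have dAB : Disjoint A B := by
    rw [disjoint_left]; intro P hPA hPB
    have e := (tag2 hPA).symm.trans (tag2 hPB)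
    simp only [Prod.mk.injEq] at e
    exact hx2 e.2.symm
  have dABC : Disjoint (A.disjUnion B dAB) C := by
    rw [disjoint_left]; intro P hP hPC
    have eC := tag2 hPC
    rcases mem_disjUnion.1 hP with h | h
    · have e := (tag2 h).symm.trans eC
      simp only [Prod.mk.injEq] at e
      exact hx1 e.1.symm
    · have e := (tag2 h).symm.trans eC
      simp only [Prod.mk.injEq] at e
      exact hx1 e.1.symm
  have dABCD : Disjoint ((A.disjUnion B dAB).disjUnion C dABC) D := by
    rw [disjoint_left]; intro P hP hPD
    have eD := tag2 hPD
    rcases mem_disjUnion.1 hP with h | h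
    · rcases mem_disjUnion.1 h with h | h
      · have e := (tag2 h).symm.trans eD
        simp only [Prod.mk.injEq] at e
        exact hy1 e.1.symm
      · have e := (tag2 h).symm.trans eD
        simp only [Prod.mk.injEq] at e
        exact hy1 e.1.symm
    · have e := (tag2 h).symm.trans eD
      simp only [Prod.mk.injEq] at e
      exact hx1y1 e.1
  set J := ((A.disjUnion B dAB).disjUnion C dABC).disjUnion D dABCD with hJ
  have cases : ∀ {P : G × G × G}, P ∈ J →
      (∃ k ∈ K, P = ((1 : G) * k, 1, 1)) ∨ (∃ k ∈ K, P = (x₂⁻¹ * c * k, 1, x₂)) ∨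
        (∃ k ∈ K, P = (y₂⁻¹ * x₁⁻¹ * c * k, x₁, y₂)) ∨ (∃ k ∈ K, P = (y₂⁻¹ * y₁⁻¹ * c * k, y₁, y₂)) := by
    intro P hP
    rcases mem_disjUnion.1 hP with h | h
    · rcases mem_disjUnion.1 h with h | h
      · rcases mem_disjUnion.1 h with h | h
        · exact Or.inl (mem_part h)
        · exact Or.inr (Or.inl (mem_part h))
      · exact Or.inr (Or.inr (Or.inl (mem_part h)))
    · exact Or.inr (Or.inr (Or.inr (mem_part h)))
  refine ⟨{1, x₁, y₁}, {1, x₂, y₂}, J, ?_, ?_, ?_, ?_, ?_⟩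
  · rw [card_insert_of_notMem (by simp [hx1.symm, hy1.symm]), card_insert_of_notMem (by simpa using hx1y1), card_singleton]
  · rw [card_insert_of_notMem (by simp [hx2.symm, hy2.symm]), card_insert_of_notMem (by simpa using hx2y2), card_singleton]
  · intro P hP
    simp only [mem_product, mem_univ, true_and, mem_insert, mem_singleton]
    rcases cases hP with ⟨k, -, rfl⟩ | ⟨k, -, rfl⟩ | ⟨k, -, rfl⟩ | ⟨k, -, rfl⟩ <;> simp
  · -- independence: sixteen cases, one normalisation
    intro P hP P' hP' hne hw
    rcases cases hP with ⟨k, hk, rfl⟩ | ⟨k, hk, rfl⟩ | ⟨k, hk, rfl⟩ | ⟨k, hk, rfl⟩ <;>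
      rcases cases hP' with ⟨k', hk', rfl⟩ | ⟨k', hk', rfl⟩ | ⟨k', hk', rfl⟩ | ⟨k', hk', rfl⟩ <;>
      simp only [cellWord] at hw <;> have e := solve_left hw <;>
      simp only [mul_assoc, mul_inv_rev, inv_inv, inv_one, one_mul, mul_one, hcinv, hcc2, ccl, cce,
        cxy.left_comm, cyy.left_comm, cxy.inv_left.left_comm, cyy.inv_left.left_comm,
        cxx.inv_right.left_comm, cxy.inv_right.left_comm, cyx.inv_right.left_comm, cyy.inv_right.left_comm,
        R1, R1', R2, R2', mul_inv_cancel_left] at e <;>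
      first
        | exact (noC k' hk' k hk e.symm).elim
        | (apply hne; rw [e])
  · rw [hJ, card_disjUnion, card_disjUnion, card_disjUnion, hA, hB, hC, hD, card_part, card_part, card_part,
      card_part, ← cardK]
    ring

/-- **A finite group with two commuting pairs sharing a central involution as commutator is NOT box-useful** (box ratio `≥ 2`).
[folklore] -/
theorem not_boxUseful_of_two_pairs [Fintype G] [DecidableEq G] {x₁ y₁ x₂ y₂ c : G}
    (h1 : x₁ * y₁ * x₁⁻¹ * y₁⁻¹ = c) (h2 : x₂ * y₂ * x₂⁻¹ * y₂⁻¹ = c)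
    (hxx : x₁ * x₂ = x₂ * x₁) (hxy : x₁ * y₂ = y₂ * x₁) (hyx : y₁ * x₂ = x₂ * y₁) (hyy : y₁ * y₂ = y₂ * y₁)
    (hc : c ∈ Subgroup.center G) (hc1 : c ≠ 1) (hcc : c * c = 1) : ¬ BoxUseful G := by
  obtain ⟨Y, W, J, hY, hW, hJ, hind, hcard⟩ := exists_indep_two h1 h2 hxx hxy hyx hyy hc hc1 hcc
  exact not_boxUseful_of_indep hY hW hJ hind (by rw [hcard]; omega)

end CommPairs

end Summit.MatrixMultiplication.OmegaCensus
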